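import Literature.NumberTheory.Automorphic.ResGLnArchCoefficientModule
import Literature.NumberTheory.Automorphic.GLnCoeffModuleAdmissibleForm
import Literature.NumberTheory.Automorphic.PosFormTensorProduct
import HarnessLib

/-!
# An admissible inner product on the archimedean coefficient module `E_λ(ℂ) = ⨂_τ V_{λ_τ}(ℂ)`

Topic `NumberTheory/Automorphic`; namespace `Literature.NumberTheory.Automorphic.AdmissibleForm`
(sequel of `GLnCoeffModuleAdmissibleForm`, `PosFormTensorProduct`).  Definitions with bodies and
theorems; no named fact, no `sorry`.

For `G_∞ = GL_n(K_∞)` (`archGroupGL n K`, `K_∞ = mixedSpace K` a real `*`-algebra) and the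
coefficient representation `archCoeffRep n K λ` on
`ResGLnCohomology.CoeffModule ℂ n K λ = ⨂_{τ : K → ℂ} V_{λ_τ}(ℂ)` (each factor `V_{λ_τ}` pulled back
along `τ̃ : K_∞ → ℂ`), we build an ADMISSIBLE scalar product [cite: BorelWallach2000, II §2.2]:

* `embeddingExt_star` — `τ̃` is a `*`-morphism: `τ̃ (x⋆) = conj (τ̃ x)`; hence
  `GL_n(τ̃) (g⋆) = (GL_n(τ̃) g)⋆` (`map_embeddingExt_star`);
* `basisForm B` — the form making a basis `B` orthonormal (`stdForm` of coordinates):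
  positive definite (`isPosForm_basisForm`) and `⟨f v, w⟩ = ⟨v, f' w⟩` as soon as the matrix of
  `f'` in `B` is the conjugate transpose of that of `f` (`basisForm_map_left`); the matrix of
  `⨂_τ f_τ` in a tensor basis is `∏_τ (f_τ)_{I τ, J τ}` (`toMatrix_piTensorProduct_map`), so
  factorwise adjoints give an adjoint (`toMatrix_piTensorProduct_map_conjTranspose`);
* `archForm n K λ` — `basisForm` of the tensor basis of orthonormal bases of the factors
  `V_{λ_τ}(ℂ)` for their admissible forms `coeffForm` (`GLnCoeffModuleAdmissibleForm`,
  `Kuga.IsPosForm.exists_orthonormal_basis`): **`isPosForm_archForm`**,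
  **`archForm_archCoeffRep_left`**: `⟨E_λ(g) v, w⟩ = ⟨v, E_λ(g⋆) w⟩` (`starArch g` the element of
  `G_∞` with matrix `gᴴ`), and **`archForm_archCoeffRep_unitary`**: `K_∞ = {k⋆ k = 1}` acts
  unitarily.

Input (b) of Step 2 of Borel's injectivity of cuspidal cohomology in the cone model
(`ResGLnCuspidalCohomologyApex`): with the Petersson form on cusp forms, `Kuga.tensorForm`
(`PosFormTensorProduct`) produces the positive form on `W ⊗ E_λ` fed to Kuga's lemma.

## References

* A. Borel, N. Wallach, *Continuous cohomology, discrete subgroups, and representations of reductive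
  groups*, 2nd ed. (2000), II §2.2 (admissible scalar products; held). [BorelWallach2000]
* A. Borel, H. Jacquet, Corvallis (1979), §1.1, §4.1 (`G_∞`, `τ̃`). [BorelJacquet1979]
-/

noncomputable section

-- `Classical`: the place subtypes indexing `mixedSpace K` are `Fintype` classically (as in `AdelicGLnGlue`).
open scoped ComplexConjugate Matrix TensorProduct Classical
open Finset PiTensorProduct _root_.NumberField _root_.NumberField.InfinitePlace _root_.NumberField.mixedEmbedding

namespace Literature.NumberTheory.Automorphic

namespace AdmissibleForm

/-! ### `τ̃` is a `*`-morphism -/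

section Star

variable {K : Type} [Field K]

/-- **`τ̃ (x⋆) = conj (τ̃ x)`**: the extension `τ̃ : K_∞ → ℂ` of a complex embedding intertwines
the involution of the real `*`-algebra `K_∞ = ℝ^{r₁} × ℂ^{r₂}` with complex conjugation.
[cite: BorelJacquet1979, §1.1] -/
theorem embeddingExt_star (τ : K →+* ℂ) (x : mixedSpace K) :
    embeddingExt τ (star x) = conj (embeddingExt τ x) := by
  classical
  by_cases hw : (mk τ).IsReal
  · rw [embeddingExt_of_isReal hw, evalRealAlgHom_apply, evalRealAlgHom_apply, Prod.fst_star, Pi.star_apply,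
      star_trivial, Complex.conj_ofReal]
  · by_cases h : (mk τ).embedding = τ
    · rw [embeddingExt_of_eq hw h, evalComplexAlgHom_apply, evalComplexAlgHom_apply, Prod.snd_star, Pi.star_apply,
        Complex.star_def]
    · rw [embeddingExt_of_ne hw h, AlgHom.comp_apply, AlgHom.comp_apply, evalComplexAlgHom_apply,
        evalComplexAlgHom_apply, Prod.snd_star, Pi.star_apply, Complex.star_def]
      rfl

variable {n : ℕ}

/-- **`GL_n(τ̃) (g⋆) = (GL_n(τ̃) g)⋆`** (`⋆` = conjugate transpose on both sides). [folklore] -/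
theorem map_embeddingExt_star (τ : K →+* ℂ) (g : GL (Fin n) (mixedSpace K)) :
    Matrix.GeneralLinearGroup.map (embeddingExt τ : mixedSpace K →+* ℂ) (star g) =
      star (Matrix.GeneralLinearGroup.map (embeddingExt τ : mixedSpace K →+* ℂ) g) := by
  refine Units.ext ?_
  rw [Units.coe_star, Matrix.star_eq_conjTranspose]
  change ((star g : GL (Fin n) (mixedSpace K)) : Matrix (Fin n) (Fin n) (mixedSpace K)).map (embeddingExt τ) =
    (((g : GL (Fin n) (mixedSpace K)) : Matrix (Fin n) (Fin n) (mixedSpace K)).map (embeddingExt τ))ᴴ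
  rw [Units.coe_star, Matrix.star_eq_conjTranspose]
  exact Matrix.conjTranspose_map _ (embeddingExt_star τ)

variable [NumberField K]

/-- The element `g⋆ ∈ G_∞` with matrix `gᴴ` (`G_∞` is all of `GL_n(K_∞)`). [folklore] -/
def starArch (g : (archGroupGL n K).carrier) : (archGroupGL n K).carrier :=
  ⟨star (g : GL (Fin n) (mixedSpace K)),
    show star (g : GL (Fin n) (mixedSpace K)) ∈ (⊤ : Subgroup (GL (Fin n) (mixedSpace K))) from Subgroup.mem_top _⟩

/-- The matrix of `g⋆`. [folklore] -/
theorem coe_starArch (g : (archGroupGL n K).carrier) :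
    ((starArch g : (archGroupGL n K).carrier) : GL (Fin n) (mixedSpace K)) = star (g : GL (Fin n) (mixedSpace K)) :=
  rfl

/-- `(k⋆) k = 1` in `G_∞` for `kᴴ k = 1`. [folklore] -/
theorem starArch_mul_self_eq_one {k : (archGroupGL n K).carrier}
    (hk : ((k : GL (Fin n) (mixedSpace K)) : Matrix (Fin n) (Fin n) (mixedSpace K))ᴴ *
      ((k : GL (Fin n) (mixedSpace K)) : Matrix (Fin n) (Fin n) (mixedSpace K)) = 1) :
    starArch k * k = 1 := by
  refine Subtype.ext (Units.ext ?_)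
  change ((star (k : GL (Fin n) (mixedSpace K)) : GL (Fin n) (mixedSpace K)) : Matrix (Fin n) (Fin n) (mixedSpace K)) *
    ((k : GL (Fin n) (mixedSpace K)) : Matrix (Fin n) (Fin n) (mixedSpace K)) = 1
  rw [Units.coe_star, Matrix.star_eq_conjTranspose, hk]

end Star

/-! ### The form making a basis orthonormal -/

section BasisForm

variable {V : Type*} [AddCommGroup V] [Module ℂ V] {ι : Type*} [Fintype ι] [DecidableEq ι]
  (B : Module.Basis ι ℂ V)

/-- The positive Hermitian form making the basis `B` orthonormal: `⟨v, w⟩ = ∑_I conj (v_I) w_I`.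
[folklore] -/
def basisForm (v w : V) : ℂ :=
  stdForm (⇑(B.repr v)) (⇑(B.repr w))

omit [DecidableEq ι] in
/-- Unfolding. [folklore] -/
theorem basisForm_apply (v w : V) : basisForm B v w = stdForm (⇑(B.repr v)) (⇑(B.repr w)) :=
  rfl

omit [DecidableEq ι] in
/-- `basisForm B` is positive definite Hermitian. [folklore] -/
theorem isPosForm_basisForm : Kuga.IsPosForm (basisForm B) where
  add_left x y z := by
    rw [basisForm_apply, basisForm_apply, basisForm_apply, map_add, Finsupp.coe_add, isPosForm_stdForm.add_left]
  smul_left c x y := by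
    rw [basisForm_apply, basisForm_apply, map_smul, Finsupp.coe_smul, isPosForm_stdForm.smul_left]
  conj_symm x y := by
    rw [basisForm_apply, basisForm_apply, isPosForm_stdForm.conj_symm]
  nonneg x := isPosForm_stdForm.nonneg _
  definite x hx := by
    have h := isPosForm_stdForm.definite _ hx
    have h' : B.repr x = 0 := Finsupp.ext fun I => congrFun h I
    exact (LinearEquiv.map_eq_zero_iff _).1 h'

/-- `B` is orthonormal for `basisForm B`. [folklore] -/
theorem basisForm_basis (i j : ι) : basisForm B (B i) (B j) = if i = j then 1 else 0 := by
  rw [basisForm_apply, B.repr_self, B.repr_self, stdForm_apply]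
  simp only [Finsupp.single_apply]
  rw [Finset.sum_eq_single i (fun x _ hx => by rw [if_neg (Ne.symm hx), map_zero, zero_mul])
    (fun h => absurd (mem_univ i) h), if_pos rfl, map_one, one_mul]
  by_cases h : i = j
  · subst h
    rfl
  · rw [if_neg (Ne.symm h), if_neg h]

/-- **Adjointness through matrices**: `⟨f v, w⟩ = ⟨v, f' w⟩` whenever the matrix of `f'` in `B`
is the conjugate transpose of that of `f`. [folklore] -/
theorem basisForm_map_left {f f' : V →ₗ[ℂ] V}
    (hf : LinearMap.toMatrix B B f' = (LinearMap.toMatrix B B f)ᴴ) (v w : V) :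
    basisForm B (f v) w = basisForm B v (f' w) := by
  rw [basisForm_apply, basisForm_apply, ← LinearMap.toMatrix_mulVec_repr B B f v,
    ← LinearMap.toMatrix_mulVec_repr B B f' w, hf, stdForm_mulVec_left]

end BasisForm

/-! ### Matrices of tensor products of maps -/

section PiMatrix

variable {κ : Type*} [Fintype κ] [DecidableEq κ] {V : κ → Type*} [∀ k, AddCommGroup (V k)] [∀ k, Module ℂ (V k)]
  {ι : κ → Type*} [∀ k, Fintype (ι k)] [∀ k, DecidableEq (ι k)] (b : ∀ k, Module.Basis (ι k) ℂ (V k))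

/-- **The matrix of `⨂_k f_k` in the tensor basis**: `(⨂ f_k)_{I J} = ∏_k (f_k)_{I k, J k}`.
[folklore] -/
theorem toMatrix_piTensorProduct_map (f : ∀ k, V k →ₗ[ℂ] V k) (I J : ∀ k, ι k) :
    LinearMap.toMatrix (Basis.piTensorProduct b) (Basis.piTensorProduct b) (PiTensorProduct.map f) I J =
      ∏ k, LinearMap.toMatrix (b k) (b k) (f k) (I k) (J k) := by
  rw [LinearMap.toMatrix_apply, Basis.piTensorProduct_apply, PiTensorProduct.map_tprod,
    Basis.piTensorProduct_repr_tprod_apply]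
  exact prod_congr rfl fun k _ => by rw [LinearMap.toMatrix_apply]

/-- Factorwise conjugate-transpose matrices give a conjugate-transpose matrix for `⨂_k f_k`.
[folklore] -/
theorem toMatrix_piTensorProduct_map_conjTranspose (f f' : ∀ k, V k →ₗ[ℂ] V k)
    (hf : ∀ k, LinearMap.toMatrix (b k) (b k) (f' k) = (LinearMap.toMatrix (b k) (b k) (f k))ᴴ) :
    LinearMap.toMatrix (Basis.piTensorProduct b) (Basis.piTensorProduct b) (PiTensorProduct.map f') =
      (LinearMap.toMatrix (Basis.piTensorProduct b) (Basis.piTensorProduct b) (PiTensorProduct.map f))ᴴ := by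
  ext I J
  rw [Matrix.conjTranspose_apply, toMatrix_piTensorProduct_map, toMatrix_piTensorProduct_map, Complex.star_def,
    map_prod]
  exact prod_congr rfl fun k _ => by rw [hf k, Matrix.conjTranspose_apply, Complex.star_def]

end PiMatrix

/-! ### The admissible form on `E_λ(ℂ) = ⨂_τ V_{λ_τ}(ℂ)` -/

section Arch

variable (n : ℕ) (K : Type) [Field K] [NumberField K] (lam : (K →+* ℂ) → Fin n → ℤ)

/-- An orthonormal basis of the factor `V_{λ_τ}(ℂ)` for its admissible form `coeffForm`
(Gram–Schmidt, `Kuga.IsPosForm.exists_orthonormal_basis`). [folklore] -/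
def factorONB (τ : K →+* ℂ) :
    Module.Basis (Fin (Module.finrank ℂ (GLnCohomology.CoeffModule ℂ n (lam τ)))) ℂ
      (GLnCohomology.CoeffModule ℂ n (lam τ)) :=
  haveI := ParallelWeight.finiteDimensional_coeffModule n (lam τ)
  Classical.choose (isPosForm_coeffForm n (lam τ)).exists_orthonormal_basis

omit [NumberField K] in
/-- `factorONB` is orthonormal for `coeffForm`. [folklore] -/
theorem factorONB_orthonormal (τ : K →+* ℂ) (i j : Fin (Module.finrank ℂ (GLnCohomology.CoeffModule ℂ n (lam τ)))) :
    coeffForm n (lam τ) (factorONB n K lam τ i) (factorONB n K lam τ j) = if i = j then 1 else 0 :=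
  haveI := ParallelWeight.finiteDimensional_coeffModule n (lam τ)
  Classical.choose_spec (isPosForm_coeffForm n (lam τ)).exists_orthonormal_basis i j

/-- The tensor basis of `E_λ(ℂ)` made of the orthonormal bases of the factors. [folklore] -/
def archBasis : Module.Basis (∀ τ : K →+* ℂ, Fin (Module.finrank ℂ (GLnCohomology.CoeffModule ℂ n (lam τ)))) ℂ
    (ResGLnCohomology.CoeffModule ℂ n K lam) :=
  show Module.Basis _ ℂ (⨂[ℂ] τ : (K →+* ℂ), GLnCohomology.CoeffModule ℂ n (lam τ)) from
    Basis.piTensorProduct (factorONB n K lam)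

/-- **The admissible form on `E_λ(ℂ)`**: the tensor basis of the factor orthonormal bases is
orthonormal. [cite: BorelWallach2000, II §2.2] -/
def archForm (v w : ResGLnCohomology.CoeffModule ℂ n K lam) : ℂ :=
  basisForm (archBasis n K lam) v w

/-- The admissible form on `E_λ(ℂ)` is positive definite Hermitian. [folklore] -/
theorem isPosForm_archForm : Kuga.IsPosForm (archForm n K lam) :=
  isPosForm_basisForm (archBasis n K lam)

/-- `archCoeffRep g` is the tensor product of the factor representations (as a linear map on the
underlying `PiTensorProduct`). [folklore] -/
theorem archCoeffRep_eq_map (g : (archGroupGL n K).carrier) :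
    (ResGLnCohomology.archCoeffRep n K lam g : ResGLnCohomology.CoeffModule ℂ n K lam →ₗ[ℂ] _) =
      (PiTensorProduct.map fun τ => ParallelWeight.factorRep K n (lam τ) τ g :
        (⨂[ℂ] τ : (K →+* ℂ), GLnCohomology.CoeffModule ℂ n (lam τ)) →ₗ[ℂ] _) :=
  rfl

/-- Factorwise admissibility: `⟨V(τ̃ g) v, w⟩ = ⟨v, V(τ̃ g⋆) w⟩` for the admissible form of
`V_{λ_τ}(ℂ)`. [cite: BorelWallach2000, II §2.2] -/
theorem coeffForm_factorRep_left (τ : K →+* ℂ) (g : (archGroupGL n K).carrier)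
    (v w : GLnCohomology.CoeffModule ℂ n (lam τ)) :
    coeffForm n (lam τ) (ParallelWeight.factorRep K n (lam τ) τ g v) w =
      coeffForm n (lam τ) v (ParallelWeight.factorRep K n (lam τ) τ (starArch g) w) := by
  rw [ParallelWeight.factorRep_apply, ParallelWeight.factorRep_apply, coeffForm_coeffRepGL_left, coe_starArch,
    map_embeddingExt_star]

/-- **Admissibility of `E_λ(ℂ)`**: `⟨E_λ(g) v, w⟩ = ⟨v, E_λ(g⋆) w⟩`, `g⋆` the element of `G_∞` with
matrix `gᴴ`.  Hence Hermitian matrices act self-adjointly and `K_∞` unitarily.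
[cite: BorelWallach2000, II §2.2] -/
theorem archForm_archCoeffRep_left (g : (archGroupGL n K).carrier) (v w : ResGLnCohomology.CoeffModule ℂ n K lam) :
    archForm n K lam (ResGLnCohomology.archCoeffRep n K lam g v) w =
      archForm n K lam v (ResGLnCohomology.archCoeffRep n K lam (starArch g) w) := by
  rw [archForm, archForm, archCoeffRep_eq_map, archCoeffRep_eq_map]
  refine basisForm_map_left (archBasis n K lam) ?_ v w
  exact toMatrix_piTensorProduct_map_conjTranspose (factorONB n K lam) _ _ fun τ =>
    (isPosForm_coeffForm n (lam τ)).toMatrix_adjoint (factorONB n K lam τ) (factorONB_orthonormal n K lam τ)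
      (coeffForm_factorRep_left n K lam τ g)

/-- **Unitarity of `K_∞`**: `⟨E_λ(k) v, E_λ(k) w⟩ = ⟨v, w⟩` for `kᴴ k = 1`.
[cite: BorelWallach2000, II §2.2] -/
theorem archForm_archCoeffRep_unitary {k : (archGroupGL n K).carrier}
    (hk : ((k : GL (Fin n) (mixedSpace K)) : Matrix (Fin n) (Fin n) (mixedSpace K))ᴴ *
      ((k : GL (Fin n) (mixedSpace K)) : Matrix (Fin n) (Fin n) (mixedSpace K)) = 1)
    (v w : ResGLnCohomology.CoeffModule ℂ n K lam) :
    archForm n K lam (ResGLnCohomology.archCoeffRep n K lam k v) (ResGLnCohomology.archCoeffRep n K lam k w) =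
      archForm n K lam v w := by
  rw [archForm_archCoeffRep_left, ← Module.End.mul_apply, ← map_mul, starArch_mul_self_eq_one hk, map_one,
    Module.End.one_apply]

end Arch

/-! ### The Lie algebra: `⟨dE_λ(X) v, w⟩ = ⟨v, dE_λ(X⋆) w⟩` -/

section LieStar

variable {K : Type} [Field K] [NumberField K] {n : ℕ}

/-- The element `X⋆ ∈ 𝔤 = M_n(K_∞)` with matrix `Xᴴ` (`𝔤` is all of `M_n(K_∞)`). [folklore] -/
def starLie (X : (archGroupGL n K).lie) : (archGroupGL n K).lie :=
  ⟨(X : Matrix (Fin n) (Fin n) (mixedSpace K))ᴴ, by simp only [archGroupGL_lie, LieSubalgebra.mem_top]⟩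

/-- The matrix of `X⋆`. [folklore] -/
theorem coe_starLie (X : (archGroupGL n K).lie) :
    ((starLie X : (archGroupGL n K).lie) : Matrix (Fin n) (Fin n) (mixedSpace K)) =
      (X : Matrix (Fin n) (Fin n) (mixedSpace K))ᴴ :=
  rfl

/-- `τ̃ (X⋆) = (τ̃ X)ᴴ` entrywise. [folklore] -/
theorem map_embeddingExt_starLie (τ : K →+* ℂ) (X : (archGroupGL n K).lie) :
    ((starLie X : (archGroupGL n K).lie) : Matrix (Fin n) (Fin n) (mixedSpace K)).map (embeddingExt τ) =
      ((X : Matrix (Fin n) (Fin n) (mixedSpace K)).map (embeddingExt τ))ᴴ := by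
  rw [coe_starLie]
  exact Matrix.conjTranspose_map _ (embeddingExt_star τ)

end LieStar

section LieTensor

open RealMatrixGroup Literature.NumberTheory.DiophantineGeometry

variable {K : Type} [Field K] [NumberField K] {n : ℕ}

/-- The Leibniz differential on tensor space is a sum of tensor products of matrices:
`d(⊗^d τ̃)(X) = ∑_a 1 ⊗ ⋯ ⊗ τ̃(X) ⊗ ⋯ ⊗ 1`. [cite: BorelWallach2000, 0 §2.3] -/
theorem stdPowLie_eq_sum_tpMap (τ : K →+* ℂ) (d : ℕ) (X : (archGroupGL n K).lie) :
    (ParallelWeight.stdPowLie K n τ d X : TensorPower ℂ d (Fin n → ℂ) →ₗ[ℂ] TensorPower ℂ d (Fin n → ℂ)) =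
      ∑ a : Fin d, tpMap (Fin n) d (Function.update (fun _ => (1 : Matrix (Fin n) (Fin n) ℂ)) a
        ((X : Matrix (Fin n) (Fin n) (mixedSpace K)).map (embeddingExt τ))) := by
  rw [ParallelWeight.stdPowLie, PiTensor.piLie_apply]
  refine sum_congr rfl fun a _ => ?_
  rw [PiTensor.slot, tpMap]
  congr 1
  funext b
  by_cases hb : b = a
  · subst hb
    rw [Function.update_self, Function.update_self]
    exact LinearMap.ext fun v => by rw [phiStdLie_apply, Matrix.mulVecLin_apply]
  · rw [Function.update_of_ne hb, Function.update_of_ne hb, Matrix.mulVecLin_one]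
    rfl

/-- The conjugate-transpose family of `(1, …, A, …, 1)` is `(1, …, Aᴴ, …, 1)`. [folklore] -/
theorem update_one_conjTranspose {d : ℕ} (a : Fin d) (A : Matrix (Fin n) (Fin n) ℂ) :
    (fun b => (Function.update (fun _ => (1 : Matrix (Fin n) (Fin n) ℂ)) a A b)ᴴ) =
      Function.update (fun _ => (1 : Matrix (Fin n) (Fin n) ℂ)) a Aᴴ := by
  funext b
  by_cases hb : b = a
  · subst hb
    rw [Function.update_self, Function.update_self]
  · rw [Function.update_of_ne hb, Function.update_of_ne hb, Matrix.conjTranspose_one]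

/-- **`⟨d(⊗^d τ̃)(X) t, t'⟩ = ⟨t, d(⊗^d τ̃)(X⋆) t'⟩`** on tensor space. [cite: BorelWallach2000, II §2.2] -/
theorem tpForm_stdPowLie_left (τ : K →+* ℂ) (d : ℕ) (X : (archGroupGL n K).lie)
    (t t' : TensorPower ℂ d (Fin n → ℂ)) :
    tpForm (Fin n) d (ParallelWeight.stdPowLie K n τ d X t) t' =
      tpForm (Fin n) d t (ParallelWeight.stdPowLie K n τ d (starLie X) t') := by
  rw [stdPowLie_eq_sum_tpMap, stdPowLie_eq_sum_tpMap, LinearMap.sum_apply, LinearMap.sum_apply,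
    (isPosForm_tpForm (Fin n) d).sum_left, (isPosForm_tpForm (Fin n) d).sum_right]
  refine sum_congr rfl fun a _ => ?_
  rw [tpForm_tpMap_left, update_one_conjTranspose, map_embeddingExt_starLie]

variable (wt : Fin n → ℤ)

/-- The underlying tensor of `dV_wt(X) v`: the Leibniz differential plus the determinant
character. [folklore] -/
theorem coe_factorLie_apply (τ : K →+* ℂ) (X : (archGroupGL n K).lie) (v : GLnCohomology.CoeffModule ℂ n wt) :
    ((GLnCohomology.CoeffModule.toWeyl ℂ (ParallelWeight.factorLie K n wt τ X v) :
        weylModule ℂ (Fin n) (GLnCohomology.coeffPartition wt)) :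
      TensorPower ℂ (GLnCohomology.coeffDegree wt) (Fin n → ℂ)) =
      ParallelWeight.stdPowLie K n τ (GLnCohomology.coeffDegree wt) X
          ((GLnCohomology.CoeffModule.toWeyl ℂ v : weylModule ℂ (Fin n) (GLnCohomology.coeffPartition wt)) :
            TensorPower ℂ (GLnCohomology.coeffDegree wt) (Fin n → ℂ)) +
        detCharLie (archGroupGL n K) (embeddingExt τ) (GLnCohomology.lowestEntry wt) X •
          ((GLnCohomology.CoeffModule.toWeyl ℂ v : weylModule ℂ (Fin n) (GLnCohomology.coeffPartition wt)) :
            TensorPower ℂ (GLnCohomology.coeffDegree wt) (Fin n → ℂ)) := by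
  rw [ParallelWeight.factorLie, twistLie_apply]
  rfl

/-- **`⟨dV(X) v, w⟩ = ⟨v, dV(X⋆) w⟩`** for the admissible form of `V_wt(ℂ)` (the determinant character
contributes `m · tr`, and `tr (Aᴴ) = conj (tr A)`). [cite: BorelWallach2000, II §2.2] -/
theorem coeffForm_factorLie_left (τ : K →+* ℂ) (X : (archGroupGL n K).lie) (v w : GLnCohomology.CoeffModule ℂ n wt) :
    coeffForm n wt (ParallelWeight.factorLie K n wt τ X v) w =
      coeffForm n wt v (ParallelWeight.factorLie K n wt τ (starLie X) w) := by
  rw [coeffForm_apply, coeffForm_apply, coe_factorLie_apply, coe_factorLie_apply,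
    (isPosForm_tpForm (Fin n) _).add_left, (isPosForm_tpForm (Fin n) _).add_right,
    (isPosForm_tpForm (Fin n) _).smul_left, (isPosForm_tpForm (Fin n) _).smul_right,
    tpForm_stdPowLie_left, detCharLie_apply, detCharLie_apply, map_embeddingExt_starLie, Matrix.trace_conjTranspose,
    Complex.star_def, map_mul, map_intCast]

end LieTensor

section LieArch

open RealMatrixGroup

variable (n : ℕ) (K : Type) [Field K] [NumberField K] (lam : (K →+* ℂ) → Fin n → ℤ)

/-- `dE_λ(X)` is the Leibniz sum of slot operators (as a linear map on the underlying
`PiTensorProduct`). [folklore] -/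
theorem archCoeffLie_eq_sum (X : (archGroupGL n K).lie) :
    (ResGLnCohomology.archCoeffLie n K lam X : ResGLnCohomology.CoeffModule ℂ n K lam →ₗ[ℂ] _) =
      (∑ τ : K →+* ℂ, PiTensor.slot τ (ParallelWeight.factorLie K n (lam τ) τ X) :
        (⨂[ℂ] τ : (K →+* ℂ), GLnCohomology.CoeffModule ℂ n (lam τ)) →ₗ[ℂ] _) :=
  rfl

/-- The matrix of a slot operator of an adjoint pair is a conjugate-transpose pair. [folklore] -/
theorem toMatrix_slot_conjTranspose (τ : K →+* ℂ) {f f' : GLnCohomology.CoeffModule ℂ n (lam τ) →ₗ[ℂ] _}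
    (hf : LinearMap.toMatrix (factorONB n K lam τ) (factorONB n K lam τ) f' =
      (LinearMap.toMatrix (factorONB n K lam τ) (factorONB n K lam τ) f)ᴴ) :
    LinearMap.toMatrix (Basis.piTensorProduct (factorONB n K lam)) (Basis.piTensorProduct (factorONB n K lam))
        (PiTensor.slot τ f') =
      (LinearMap.toMatrix (Basis.piTensorProduct (factorONB n K lam)) (Basis.piTensorProduct (factorONB n K lam))
        (PiTensor.slot τ f))ᴴ := by
  rw [PiTensor.slot, PiTensor.slot]
  refine toMatrix_piTensorProduct_map_conjTranspose (factorONB n K lam) _ _ fun σ => ?_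
  by_cases hσ : σ = τ
  · subst hσ
    rw [Function.update_self, Function.update_self, hf]
  · rw [Function.update_of_ne hσ, Function.update_of_ne hσ, LinearMap.toMatrix_one, Matrix.conjTranspose_one]

/-- Adjointness of the Leibniz sum of slot operators on `⨂_τ V_{λ_τ}` for the tensor basis form.
[cite: BorelWallach2000, II §2.2] -/
theorem basisForm_sum_slot_factorLie_left (X : (archGroupGL n K).lie)
    (v w : ⨂[ℂ] τ : (K →+* ℂ), GLnCohomology.CoeffModule ℂ n (lam τ)) :
    basisForm (Basis.piTensorProduct (factorONB n K lam))
        ((∑ τ : K →+* ℂ, PiTensor.slot τ (ParallelWeight.factorLie K n (lam τ) τ X)) v) w =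
      basisForm (Basis.piTensorProduct (factorONB n K lam)) v
        ((∑ τ : K →+* ℂ, PiTensor.slot τ (ParallelWeight.factorLie K n (lam τ) τ (starLie X))) w) := by
  rw [LinearMap.sum_apply, LinearMap.sum_apply, (isPosForm_basisForm (Basis.piTensorProduct (factorONB n K lam))).sum_left,
    (isPosForm_basisForm (Basis.piTensorProduct (factorONB n K lam))).sum_right]
  refine sum_congr rfl fun τ _ => ?_
  refine basisForm_map_left (Basis.piTensorProduct (factorONB n K lam)) ?_ v w
  exact toMatrix_slot_conjTranspose n K lam τ
    ((isPosForm_coeffForm n (lam τ)).toMatrix_adjoint (factorONB n K lam τ) (factorONB_orthonormal n K lam τ)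
      (coeffForm_factorLie_left (lam τ) τ X))

/-- **Admissibility of `E_λ(ℂ)` at the Lie algebra level**: `⟨dE_λ(X) v, w⟩ = ⟨v, dE_λ(X⋆) w⟩`; so
Hermitian `X` (`𝔭`) act self-adjointly and skew-Hermitian `X` (`𝔨`) skew-adjointly.
[cite: BorelWallach2000, II §2.2] -/
theorem archForm_archCoeffLie_left (X : (archGroupGL n K).lie) (v w : ResGLnCohomology.CoeffModule ℂ n K lam) :
    archForm n K lam (ResGLnCohomology.archCoeffLie n K lam X v) w =
      archForm n K lam v (ResGLnCohomology.archCoeffLie n K lam (starLie X) w) :=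
  basisForm_sum_slot_factorLie_left n K lam X v w

/-- Hermitian `X` act self-adjointly. [cite: BorelWallach2000, II §2.2] -/
theorem archForm_archCoeffLie_left_of_hermitian {X : (archGroupGL n K).lie}
    (hX : (X : Matrix (Fin n) (Fin n) (mixedSpace K))ᴴ = X) (v w : ResGLnCohomology.CoeffModule ℂ n K lam) :
    archForm n K lam (ResGLnCohomology.archCoeffLie n K lam X v) w =
      archForm n K lam v (ResGLnCohomology.archCoeffLie n K lam X w) := by
  have h : starLie X = X := Subtype.ext (by rw [coe_starLie]; exact hX)
  rw [archForm_archCoeffLie_left, h]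

/-- Skew-Hermitian `X` (the Lie algebra of `K_∞`) act skew-adjointly. [cite: BorelWallach2000, II §2.2] -/
theorem archForm_archCoeffLie_left_of_skew {X : (archGroupGL n K).lie}
    (hX : (X : Matrix (Fin n) (Fin n) (mixedSpace K))ᴴ = -X) (v w : ResGLnCohomology.CoeffModule ℂ n K lam) :
    archForm n K lam (ResGLnCohomology.archCoeffLie n K lam X v) w =
      -archForm n K lam v (ResGLnCohomology.archCoeffLie n K lam X w) := by
  have h : starLie X = -X := Subtype.ext (by rw [coe_starLie]; exact hX)
  rw [archForm_archCoeffLie_left, h, map_neg, LinearMap.neg_apply, (isPosForm_archForm n K lam).neg_right]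

end LieArch

end AdmissibleForm

end Literature.NumberTheory.Automorphic

end
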